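import Summits.Ventures.PercRepro.RankLevelSetStarPlusThreeLine
import Summits.Ventures.PercRepro.RankLevelSetStarPlusThreeSplit
import Summits.Ventures.PercRepro.RankLevelSetAbsorbNormClass

/-! # RankLevelSetStarPlusThree — THE REFLECTION `i = 3` OF (★★)⁺ FOR EVERY FINITE MATROID, AND (ABS-norm) ON
EVERY MATROID WITH AT MOST `8` ELEMENTS (night-1 g36; dossier §48.9; on `RankLevelSetStarPlusThreeLine`,
`RankLevelSetStarPlusThreeSplit` and `RankLevelSetAbsorbNormClass`)

**`starPlus_three`**: for every finite matroid, every `y ∈ E` and `7 ≤ #E`, `A^y_3 ≤ A^y_{#E − 3}`. A loop absorbs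
nothing; an element of a parallel pair has both sides equal to `D_2` of the minor `M ／ {y} ＼ {z}` (g32's identity
and the symmetry of the profile); a coloop `y` absorbs nothing; across a coloop `x ≠ y` the absorbing profile
splits (`lowAbsorbCount_succ_of_coloop`), so the reflection follows from `starPlus_two` and the induction; on `7`
elements it is the middle step `k = 3`. The coloop-free case at an element in no parallel pair
(**`starPlus_three_of_coloopFree`**) is counted CIRCUIT BY CIRCUIT: grouping the members `Z ∈ A^y_3` and the
targets `W ∈ A^y_{#E − 3}` by the circuit `K = C_y(·)` of `y`, a `4`-circuit `K` has at most one member (`K ∖ {y}`)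
and a target (`exists_compl_pair_mem_lowAbsorb`); a triangle `K = S + y` has the members `S + c`, `c ∈ H := E ∖ K`,
with `insert c S` and `insert y (H ∖ {c})` spanning `M✶`, and the targets `E ∖ insert y P`, `P ⊆ H` a pair with
`S ∪ (H ∖ P)` and `insert y P` spanning `M✶` — the line lemma `line_members_le_targets` of the dual (`H` a flat of
rank `≤ 2`); the per-circuit inequalities are summed over the circuits (`Finset.card_eq_sum_card_image`).
Corollaries: (★★)⁺ and (ABS-norm) on every matroid with `≤ 8` elements (**`biIndepStarPlus_of_ncard_le_eight`**,
**`absorbNormSkew_of_ncard_le_eight`**). Every declaration has a docstring; imports: the cell's own modules and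
Mathlib only. Axioms: standard. -/

namespace PercRepro

open Set Matroid

variable {α : Type} (M : Matroid α) [M.Finite]

/-! ## The coloop-free case, circuit by circuit -/

/-- **The reflection `i = 3` for a coloop-free matroid at an element in no parallel pair** (`8 ≤ #E`):
`A^y_3 ≤ A^y_{#E − 3}`, circuit by circuit. -/
theorem starPlus_three_of_coloopFree (hcol : ∀ e, ¬ M.IsColoop e) {y : α} (hy : y ∈ M.E)
    (hnp : ∀ z, z ≠ y → y ∉ M.closure {z}) (hn : 8 ≤ M.E.ncard) :
    lowAbsorbCount M y 3 ≤ lowAbsorbCount M y (M.E.ncard - 3) := by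
  classical
  unfold lowAbsorbCount
  set f : Set α → Set α := fun Z => M.fundCircuit y Z with hf
  have hmfin : (lowAbsorbAt M y 3).Finite := lowAbsorbAt_finite M y 3
  have htfin : (lowAbsorbAt M y (M.E.ncard - 3)).Finite := lowAbsorbAt_finite M y _
  -- a second element of the ground set
  obtain ⟨z₀, hz₀⟩ : (M.E \ {y}).Nonempty := by
    rw [← Set.ncard_pos (M.ground_finite.subset Set.sdiff_subset), Set.ncard_sdiff_singleton_of_mem hy]
    omega
  have hz₀y : z₀ ≠ y := by simpa using hz₀.2
  -- THE PER-CIRCUIT INEQUALITY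
  have hperK : ∀ Z₀ ∈ lowAbsorbAt M y 3,
      {Z ∈ lowAbsorbAt M y 3 | f Z = f Z₀}.ncard ≤
        {W ∈ lowAbsorbAt M y (M.E.ncard - 3) | f W = f Z₀}.ncard := by
    intro Z₀ hZ₀
    obtain ⟨h3, h4⟩ := fundCircuit_ncard_absorb M hy hnp hz₀y hZ₀
    have hycl₀ := mem_closure_of_mem_lowAbsorbAt' M hy hZ₀
    obtain ⟨T, hTJ, hT2, hWabs, hWC⟩ := exists_compl_pair_mem_lowAbsorb M hy (by omega) hZ₀
    have hKcirc : M.IsCircuit (M.fundCircuit y Z₀) := hZ₀.1.2.2.1.fundCircuit_isCircuit hycl₀ hZ₀.2.1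
    have hyK : y ∈ M.fundCircuit y Z₀ := M.mem_fundCircuit y Z₀
    have hKsub : M.fundCircuit y Z₀ ⊆ insert y Z₀ := M.fundCircuit_subset_insert y Z₀
    have hKE : M.fundCircuit y Z₀ ⊆ M.E := hKsub.trans (Set.insert_subset hy hZ₀.1.1)
    have htfin' : {W ∈ lowAbsorbAt M y (M.E.ncard - 3) | f W = f Z₀}.Finite := htfin.subset (fun W hW => hW.1)
    rcases Nat.lt_or_ge (M.fundCircuit y Z₀).ncard 4 with hlt | hge
    · -- a TRIANGLE `K = S + y`: the line lemma in the dual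
      have hK3 : (M.fundCircuit y Z₀).ncard = 3 := by omega
      set K := M.fundCircuit y Z₀ with hK
      set S := K \ {y} with hS
      set H := M.E \ K with hH
      have hSK : S ⊆ K := Set.sdiff_subset
      have hSE : S ⊆ M.E := hSK.trans hKE
      have hHE : H ⊆ M.E := Set.sdiff_subset
      have hKfin : K.Finite := M.ground_finite.subset hKE
      have hHfin : H.Finite := M.ground_finite.subset hHE
      have hyS : y ∉ S := fun h => h.2 (Set.mem_singleton y)
      have hyH : y ∉ H := fun h => h.2 hyK
      have hS2 : S.ncard = 2 := by rw [hS, Set.ncard_sdiff_singleton_of_mem hyK, hK3]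
      have hKeq : K = insert y S := by
        rw [hS, Set.insert_sdiff_singleton, Set.insert_eq_of_mem hyK]
      have hHcard : H.ncard = M.E.ncard - 3 := by
        rw [hH, Set.ncard_sdiff hKE hKfin, hK3]
      have hSH : Disjoint S H := Set.disjoint_left.mpr (fun x hxS hxH => hxH.2 (hSK hxS))
      have hSi : M.Indep S := hZ₀.1.2.2.1.subset (fun x hx => by
        rcases hKsub hx.1 with h | h
        · exact absurd h hx.2
        · exact h)
      have hKdep : ¬ M.Indep K := hKcirc.dep.not_indep
      -- the dual facts of `H`
      have hyE' : y ∈ M✶.E := by rwa [Matroid.dual_ground]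
      have hHE' : H ⊆ M✶.E := by rwa [Matroid.dual_ground]
      have hSE' : S ⊆ M✶.E := by rwa [Matroid.dual_ground]
      have hE1 : M.E \ S = insert y H := by
        ext x
        simp only [hH, hKeq, Set.mem_sdiff, Set.mem_insert_iff, not_or]
        constructor
        · rintro ⟨hxE, hxS⟩
          by_cases hxy : x = y
          · exact Or.inl hxy
          · exact Or.inr ⟨hxE, hxy, hxS⟩
        · rintro (rfl | ⟨hxE, -, hxS⟩)
          · exact ⟨hy, hyS⟩
          · exact ⟨hxE, hxS⟩
      have hHy : M✶.Spanning (insert y H) := by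
        rw [← hE1]; exact (indep_iff_dual_spanning_compl M hSE).mp hSi
      have hHns : ¬ M✶.Spanning H := fun h => hKdep ((indep_iff_dual_spanning_compl M hKE).mpr h)
      have hyHcl : y ∉ M✶.closure H := notMem_closure_of_spanning_insert hHy hHns
      have hnl : ∀ e ∈ H, M✶.IsNonloop e := by
        intro e he
        refine Matroid.isNonloop_of_not_isLoop (by rw [Matroid.dual_ground]; exact hHE he) ?_
        rw [Matroid.dual_isLoop_iff_isColoop]
        exact hcol e
      have hrk : M✶.eRk H ≤ 2 := by
        obtain ⟨-, -, -, -, -, hrank⟩ := absorb_three_dual_facts M hy hZ₀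
        have h1 := eRk_add_one_eq_eRank_of_spanning_insert hyE' hyHcl hHy
        have h2 : M✶.eRk H + 1 ≤ 2 + 1 := by rw [h1]; exact hrank
        exact (WithTop.add_le_add_iff_right (by decide)).mp h2
      have hline := line_members_le_targets hHE' hSE' hyE' hyHcl hHy (by omega) hnl hrk
      -- the members inject into the line members: `Z = insert c S`
      have hmem : {Z ∈ lowAbsorbAt M y 3 | f Z = f Z₀} ⊆
          (fun c => insert c S) '' {c ∈ H | M✶.Spanning (insert c S) ∧ M✶.Spanning (insert y (H \ {c}))} := by
        rintro Z ⟨hZ, hfZ⟩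
        have hZK : M.fundCircuit y Z = K := hfZ
        obtain ⟨⟨hZE, hZ3, hZi, hcind⟩, hyZ, hdep⟩ := hZ
        have hZfin : Z.Finite := M.ground_finite.subset hZE
        have hSZ : S ⊆ Z := by
          intro x hx
          have hxK : x ∈ M.fundCircuit y Z := by rw [hZK]; exact hx.1
          rcases M.fundCircuit_subset_insert y Z hxK with h | h
          · exact absurd h hx.2
          · exact h
        have hZS1 : (Z \ S).ncard = 1 := by
          rw [Set.ncard_sdiff hSZ (hZfin.subset hSZ), hZ3, hS2]
        obtain ⟨c, hc⟩ := Set.ncard_eq_one.mp hZS1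
        have hcZ : c ∈ Z \ S := by rw [hc]; exact Set.mem_singleton c
        have hZeq : Z = insert c S := by
          ext x
          simp only [Set.mem_insert_iff]
          constructor
          · intro hxZ
            by_cases hxS : x ∈ S
            · exact Or.inr hxS
            · left
              have : x ∈ Z \ S := ⟨hxZ, hxS⟩
              rw [hc] at this
              exact this
          · rintro (rfl | hxS)
            · exact hcZ.1
            · exact hSZ hxS
        have hcy : c ≠ y := fun h => hyZ (h ▸ hcZ.1)
        have hcH : c ∈ H := ⟨hZE hcZ.1, fun hcK => hcZ.2 ⟨hcK, by simpa using hcy⟩⟩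
        refine ⟨c, ⟨hcH, ?_, ?_⟩, hZeq.symm⟩
        · rw [← hZeq]; exact (indep_compl_iff_dual_spanning M hZE).mp hcind
        · have hE2 : M.E \ Z = insert y (H \ {c}) := by
            ext x
            simp only [hZeq, hH, hKeq, Set.mem_sdiff, Set.mem_insert_iff, Set.mem_singleton_iff, not_or]
            constructor
            · rintro ⟨hxE, hxc, hxS⟩
              by_cases hxy : x = y
              · exact Or.inl hxy
              · exact Or.inr ⟨⟨hxE, hxy, hxS⟩, hxc⟩
            · rintro (rfl | ⟨⟨hxE, -, hxS⟩, hxc⟩)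
              · exact ⟨hy, hcy.symm, hyS⟩
              · exact ⟨hxE, hxc, hxS⟩
          rw [← hE2]; exact (indep_iff_dual_spanning_compl M hZE).mp hZi
      -- the line targets inject into the targets: `P ↦ E ∖ insert y P`
      have htg : (fun P => M.E \ insert y P) ''
          {P | P ⊆ H ∧ P.ncard = 2 ∧ M✶.Spanning (S ∪ (H \ P)) ∧ M✶.Spanning (insert y P)} ⊆
          {W ∈ lowAbsorbAt M y (M.E.ncard - 3) | f W = f Z₀} := by
        rintro W ⟨P, ⟨hPH, hP2, hPs, hyPs⟩, rfl⟩
        have hPE : P ⊆ M.E := hPH.trans hHE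
        have hyP : y ∉ P := fun h => hyH (hPH h)
        have hPfin : P.Finite := hHfin.subset hPH
        have hyPE : insert y P ⊆ M.E := Set.insert_subset hy hPE
        have hWeq : M.E \ insert y P = S ∪ (H \ P) := by
          ext x
          simp only [hH, hKeq, Set.mem_sdiff, Set.mem_insert_iff, Set.mem_union, not_or]
          constructor
          · rintro ⟨hxE, hxy, hxP⟩
            by_cases hxS : x ∈ S
            · exact Or.inl hxS
            · exact Or.inr ⟨⟨hxE, hxy, hxS⟩, hxP⟩
          · rintro (hxS | ⟨⟨hxE, hxy, hxS⟩, hxP⟩)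
            · exact ⟨hSE hxS, fun h => hyS (h ▸ hxS), fun h => (hSH.le_bot ⟨hxS, hPH h⟩).elim⟩
            · exact ⟨hxE, hxy, hxP⟩
        have hWi : M.Indep (M.E \ insert y P) := by
          rw [indep_iff_dual_spanning_compl M Set.sdiff_subset, Set.sdiff_sdiff_cancel_left hyPE]
          exact hyPs
        have hSW : S ⊆ M.E \ insert y P := by rw [hWeq]; exact Set.subset_union_left
        refine ⟨⟨⟨Set.sdiff_subset, ?_, hWi, ?_⟩, fun h => h.2 (Set.mem_insert y P), ?_⟩, ?_⟩
        · rw [Set.ncard_sdiff hyPE (M.ground_finite.subset hyPE), Set.ncard_insert_of_notMem hyP hPfin, hP2]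
        · rw [indep_compl_iff_dual_spanning M Set.sdiff_subset, hWeq]; exact hPs
        · intro hind
          have heq : insert y (M.E \ insert y P) = M.E \ P := by
            ext x
            simp only [Set.mem_insert_iff, Set.mem_sdiff, not_or]
            constructor
            · rintro (rfl | ⟨hxE, -, hxP⟩)
              · exact ⟨hy, hyP⟩
              · exact ⟨hxE, hxP⟩
            · rintro ⟨hxE, hxP⟩
              by_cases hxy : x = y
              · exact Or.inl hxy
              · exact Or.inr ⟨hxE, hxy, hxP⟩
          rw [heq, indep_compl_iff_dual_spanning M hPE] at hind
          exact hHns (hind.superset hPH hHE')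
        · -- the circuit of `y` in `W` is `K`
          show M.fundCircuit y (M.E \ insert y P) = K
          have hsub : K ⊆ insert y (M.E \ insert y P) := by
            rw [hKeq]; exact Set.insert_subset_insert hSW
          exact (hKcirc.eq_fundCircuit_of_subset hWi hsub).symm
      have hinj : Set.InjOn (fun P => M.E \ insert y P)
          {P | P ⊆ H ∧ P.ncard = 2 ∧ M✶.Spanning (S ∪ (H \ P)) ∧ M✶.Spanning (insert y P)} := by
        rintro P₁ ⟨hP₁, -, -, -⟩ P₂ ⟨hP₂, -, -, -⟩ heq
        have h1 : insert y P₁ ⊆ M.E := Set.insert_subset hy (hP₁.trans hHE)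
        have h2 : insert y P₂ ⊆ M.E := Set.insert_subset hy (hP₂.trans hHE)
        have heq' : M.E \ insert y P₁ = M.E \ insert y P₂ := heq
        have h3 : insert y P₁ = insert y P₂ := by
          rw [← Set.sdiff_sdiff_cancel_left h1, ← Set.sdiff_sdiff_cancel_left h2, heq']
        have hyP₁ : y ∉ P₁ := fun h => hyH (hP₁ h)
        have hyP₂ : y ∉ P₂ := fun h => hyH (hP₂ h)
        have : (insert y P₁) \ {y} = (insert y P₂) \ {y} := by rw [h3]
        rwa [Set.insert_sdiff_of_mem _ (Set.mem_singleton y), Set.insert_sdiff_of_mem _ (Set.mem_singleton y),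
          Set.sdiff_singleton_eq_self hyP₁, Set.sdiff_singleton_eq_self hyP₂] at this
      calc {Z ∈ lowAbsorbAt M y 3 | f Z = f Z₀}.ncard
          ≤ ((fun c => insert c S) ''
              {c ∈ H | M✶.Spanning (insert c S) ∧ M✶.Spanning (insert y (H \ {c}))}).ncard :=
            Set.ncard_le_ncard hmem ((hHfin.subset (fun c hc => hc.1)).image _)
        _ ≤ {c ∈ H | M✶.Spanning (insert c S) ∧ M✶.Spanning (insert y (H \ {c}))}.ncard :=
            Set.ncard_image_le (hHfin.subset (fun c hc => hc.1))
        _ ≤ {P | P ⊆ H ∧ P.ncard = 2 ∧ M✶.Spanning (S ∪ (H \ P)) ∧ M✶.Spanning (insert y P)}.ncard := hline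
        _ = ((fun P => M.E \ insert y P) ''
              {P | P ⊆ H ∧ P.ncard = 2 ∧ M✶.Spanning (S ∪ (H \ P)) ∧ M✶.Spanning (insert y P)}).ncard :=
            hinj.ncard_image.symm
        _ ≤ {W ∈ lowAbsorbAt M y (M.E.ncard - 3) | f W = f Z₀}.ncard := Set.ncard_le_ncard htg htfin'
    · -- a `4`-CIRCUIT: at most one member (`K ∖ {y}`), at least one target
      have hK4 : (M.fundCircuit y Z₀).ncard = 4 := by omega
      have hmem1 : {Z ∈ lowAbsorbAt M y 3 | f Z = f Z₀}.ncard ≤ 1 := by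
        rw [Set.ncard_le_one_iff_eq (hmfin.subset (fun Z hZ => hZ.1))]
        rcases Set.eq_empty_or_nonempty {Z ∈ lowAbsorbAt M y 3 | f Z = f Z₀} with h0 | ⟨Z₁, hZ₁⟩
        · exact Or.inl h0
        · right
          refine ⟨Z₁, ?_⟩
          -- every member with this circuit equals `K ∖ {y}`
          have hKZ : ∀ Z ∈ {Z ∈ lowAbsorbAt M y 3 | f Z = f Z₀}, Z = M.fundCircuit y Z₀ \ {y} := by
            rintro Z ⟨hZ, hfZ⟩
            have hZK : M.fundCircuit y Z = M.fundCircuit y Z₀ := hfZ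
            obtain ⟨⟨hZE, hZ3, -, -⟩, hyZ, -⟩ := hZ
            have hZfin : Z.Finite := M.ground_finite.subset hZE
            have hCeq : M.fundCircuit y Z = insert y Z := by
              refine Set.eq_of_subset_of_ncard_le (M.fundCircuit_subset_insert y Z) ?_ (hZfin.insert y)
              rw [Set.ncard_insert_of_notMem hyZ hZfin, hZ3, hZK, hK4]
            rw [← hZK, hCeq, Set.insert_sdiff_of_mem _ (Set.mem_singleton y), Set.sdiff_singleton_eq_self hyZ]
          ext Z
          simp only [Set.mem_singleton_iff]
          constructor
          · intro hZ; rw [hKZ Z hZ, hKZ Z₁ hZ₁]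
          · intro hZ; rw [hZ]; exact hZ₁
      have htg1 : 1 ≤ {W ∈ lowAbsorbAt M y (M.E.ncard - 3) | f W = f Z₀}.ncard :=
        (Set.ncard_pos htfin').mpr ⟨M.E \ insert y T, hWabs, hWC⟩
      omega
  -- SUM OVER THE CIRCUITS
  set A := hmfin.toFinset with hA
  set B := htfin.toFinset with hB
  have hcardA : ∀ K, (A.filter (fun Z => f Z = K)).card = {Z ∈ lowAbsorbAt M y 3 | f Z = K}.ncard := by
    intro K
    rw [← Set.ncard_coe_finset, Finset.coe_filter]
    congr 1
    ext Z
    simp only [Set.mem_setOf_eq, hA, Set.Finite.mem_toFinset]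
  have hcardB : ∀ K, (B.filter (fun W => f W = K)).card =
      {W ∈ lowAbsorbAt M y (M.E.ncard - 3) | f W = K}.ncard := by
    intro K
    rw [← Set.ncard_coe_finset, Finset.coe_filter]
    congr 1
    ext W
    simp only [Set.mem_setOf_eq, hB, Set.Finite.mem_toFinset]
  have h1 : A.card = ∑ K ∈ A.image f, (A.filter (fun Z => f Z = K)).card := Finset.card_eq_sum_card_image f A
  have h2 : (B.filter (fun W => f W ∈ A.image f)).card =
      ∑ K ∈ A.image f, ((B.filter (fun W => f W ∈ A.image f)).filter (fun W => f W = K)).card :=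
    Finset.card_eq_sum_card_fiberwise (fun W hW => (Finset.mem_filter.mp hW).2)
  have h3 : ∀ K ∈ A.image f, (A.filter (fun Z => f Z = K)).card ≤
      ((B.filter (fun W => f W ∈ A.image f)).filter (fun W => f W = K)).card := by
    intro K hK
    obtain ⟨Z₀, hZ₀A, rfl⟩ := Finset.mem_image.mp hK
    have hZ₀ : Z₀ ∈ lowAbsorbAt M y 3 := hmfin.mem_toFinset.mp hZ₀A
    have hsub : B.filter (fun W => f W = f Z₀) ⊆ (B.filter (fun W => f W ∈ A.image f)).filter (fun W => f W = f Z₀) := by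
      intro W hW
      rw [Finset.mem_filter] at hW
      rw [Finset.mem_filter, Finset.mem_filter]
      exact ⟨⟨hW.1, hW.2 ▸ hK⟩, hW.2⟩
    calc (A.filter (fun Z => f Z = f Z₀)).card = {Z ∈ lowAbsorbAt M y 3 | f Z = f Z₀}.ncard := hcardA _
      _ ≤ {W ∈ lowAbsorbAt M y (M.E.ncard - 3) | f W = f Z₀}.ncard := hperK Z₀ hZ₀
      _ = (B.filter (fun W => f W = f Z₀)).card := (hcardB _).symm
      _ ≤ _ := Finset.card_le_card hsub
  have h4 : (B.filter (fun W => f W ∈ A.image f)).card ≤ B.card := Finset.card_le_card (Finset.filter_subset _ _)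
  have h5 : A.card ≤ B.card := by
    rw [h1]
    refine le_trans (Finset.sum_le_sum h3) ?_
    rw [← h2]
    exact h4
  rw [Set.ncard_eq_toFinset_card _ hmfin, Set.ncard_eq_toFinset_card _ htfin]
  exact h5

/-! ## The reflection `i = 3` for every finite matroid -/

/-- The auxiliary induction: the reflection `A^y_3 ≤ A^y_{n − 3}` on every finite matroid with `n ≥ 7` elements. -/
theorem starPlus_three_aux : ∀ n : ℕ, ∀ (M' : Matroid α) [M'.Finite], M'.E.ncard = n → ∀ y ∈ M'.E, 7 ≤ n →
    lowAbsorbCount M' y 3 ≤ lowAbsorbCount M' y (n - 3) := by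
  intro n
  induction n using Nat.strong_induction_on with
  | _ n ih =>
    intro M' _ hn y hy h7
    classical
    -- a loop absorbs nothing
    by_cases hl : M'.IsLoop y
    · rw [lowAbsorbCount_eq_zero_of_isLoop M' hl 3]; exact Nat.zero_le _
    -- an element of a parallel pair: both sides are `D_2` of the minor
    by_cases hp : ∃ z, ParallelPair M' y z
    · obtain ⟨z, hz⟩ := hp
      haveI := contract_delete_finite M' y z
      have hcard := ncard_ground_contract_delete M' hz
      rw [hn] at hcard
      have h3 : lowAbsorbCount M' y 3 = biIndepCount ((M'.contract {y}).delete {z}) 2 :=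
        lowAbsorbCount_succ_of_parallel_left M' hz 2
      have hn3 : n - 3 = (n - 4) + 1 := by omega
      have h4 : lowAbsorbCount M' y (n - 3) = biIndepCount ((M'.contract {y}).delete {z}) (n - 4) := by
        rw [hn3]; exact lowAbsorbCount_succ_of_parallel_left M' hz (n - 4)
      have hsym := biIndepCount_compl ((M'.contract {y}).delete {z}) 2 (by rw [hcard]; omega)
      rw [hcard, show n - 2 - 2 = n - 4 by omega] at hsym
      rw [h3, h4, hsym]
    -- `y` a coloop absorbs nothing
    by_cases hyc : M'.IsColoop y
    · rw [lowAbsorbCount_eq_zero_of_isColoop M' hyc 3]; exact Nat.zero_le _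
    -- a coloop `x ≠ y`: split across it
    by_cases hcol : ∃ x, M'.IsColoop x
    · obtain ⟨x, hx⟩ := hcol
      have hyx : y ≠ x := fun h => hyc (h ▸ hx)
      haveI := delete_finite' M' x
      have hcard : (M'.delete {x}).E.ncard = n - 1 := by
        rw [Matroid.delete_ground, Set.ncard_sdiff_singleton_of_mem hx.mem_ground, hn]
      have hyM : y ∈ (M'.delete {x}).E := by
        rw [Matroid.delete_ground]; exact ⟨hy, by simpa using hyx⟩
      have hA3 : lowAbsorbCount M' y 3 =
          lowAbsorbCount (M'.delete {x}) y 2 + lowAbsorbCount (M'.delete {x}) y 3 :=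
        lowAbsorbCount_succ_of_coloop M' hx hyx 2
      have hn3 : n - 3 = (n - 4) + 1 := by omega
      have hAn : lowAbsorbCount M' y (n - 3) =
          lowAbsorbCount (M'.delete {x}) y (n - 4) + lowAbsorbCount (M'.delete {x}) y (n - 3) := by
        rw [hn3]; exact lowAbsorbCount_succ_of_coloop M' hx hyx (n - 4)
      have hs2 : lowAbsorbCount (M'.delete {x}) y 2 ≤ lowAbsorbCount (M'.delete {x}) y (n - 3) := by
        have := starPlus_two (M'.delete {x}) hyM (by omega)
        rwa [hcard, show n - 1 - 2 = n - 3 by omega] at this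
      have hs3 : lowAbsorbCount (M'.delete {x}) y 3 ≤ lowAbsorbCount (M'.delete {x}) y (n - 4) := by
        rcases Nat.lt_or_ge (n - 1) 7 with h6 | h7'
        · have h6' : n - 4 = 3 := by omega
          rw [h6']
        · have := ih (n - 1) (by omega) (M'.delete {x}) hcard y hyM h7'
          rwa [show n - 1 - 3 = n - 4 by omega] at this
      rw [hA3, hAn]
      omega
    -- the coloop-free case at an element in no parallel pair
    simp only [not_exists] at hp hcol
    have hnp : ∀ z, z ≠ y → y ∉ M'.closure {z} :=
      fun z hz => notMem_closure_singleton_of_no_partner M' hy hl hp hz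
    rcases Nat.lt_or_ge n 8 with h7' | h8
    · -- `n = 7`: the middle step `k = 3`
      have hn7 : n = 7 := by omega
      have := starPlus_three_of_ncard_eq_seven M' hy (by omega)
      rw [hn] at this
      exact this
    · have := starPlus_three_of_coloopFree M' hcol hy hnp (by omega)
      rwa [hn] at this

/-- **THE REFLECTION `i = 3` OF (★★)⁺ FOR EVERY FINITE MATROID AND EVERY ELEMENT**: `A^y_3 ≤ A^y_{#E − 3}` for
`7 ≤ #E`. -/
theorem starPlus_three {y : α} (hy : y ∈ M.E) (hn : 7 ≤ M.E.ncard) :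
    lowAbsorbCount M y 3 ≤ lowAbsorbCount M y (M.E.ncard - 3) :=
  starPlus_three_aux M.E.ncard M rfl y hy hn

/-! ## (★★)⁺ and (ABS-norm) on at most `8` elements -/

/-- **(★★)⁺ holds on every matroid with at most `8` elements**: the reflections in range are `i ≤ 3`. -/
theorem biIndepStarPlus_of_ncard_le_eight (hn : M.E.ncard ≤ 8) : BiIndepStarPlus M := by
  intro y hy i hi
  rcases Nat.lt_or_ge i 3 with h3 | h3
  · exact starPlus_of_le_two M hy (by omega) hi
  · have hi3 : i = 3 := by omega
    subst hi3
    exact starPlus_three M hy (by omega)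

/-- **(ABS-norm) holds on every matroid with at most `8` elements**: the full normalized half rule of the absorbing
avoid-`y` profile with the full parameter `#E`, at every element. -/
theorem absorbNormSkew_of_ncard_le_eight [DecidableEq α] (hn : M.E.ncard ≤ 8) : BiIndepAbsorbNormSkew M :=
  absorbNormSkew_of_absorbStar M (absorbStar_of_ncard_le_eight M hn) (biIndepStarPlus_of_ncard_le_eight M hn)

end PercRepro
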